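import Summits.Ventures.PercRepro.SixFourResidueThreeXbar2A
import Summits.Ventures.PercRepro.SixFourResidueThreeList
import Summits.Ventures.PercRepro.SixFourResidueThreeIdentity

/-!
# PercRepro — C-025 at `(6,4)`: Lemma X̄₂ (E21-1 (b)), part B — the third shape and the count (p2, gen 8)

`shape_third`: if `G ∖ Z ⊆ P′` with `P′ ∩ G = {x} ∪ λ` (`x ∈ L`, `λ = P′ ∩ ρ` a non-class line trace) and `r(Z) ≤ 2`,
then `(ρ ∖ λ) ∪ (L ∖ {x}) ⊆ Z` is collinear, so `ρ ∖ λ ⊆ ℓ ∩ ρ` — the meeting case, `|ℓ ∩ ρ| = 1` and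
`|λ| + 1 = p` — and `Z ∈ {ℓ′ ∖ {x}, ℓ′}` with `ℓ′ = ℓ ∩ G`.  **`X2cnt_le_Xbar2_profile`**: every set counted by `X₂`
is in one of the three families `{L, L ∪ (ℓ ∩ ρ)}` (`≤ 1 + e`), `{ρ ∖ λ_y, cl(ρ ∖ λ_y) ∩ ρ}` over the classes with
`inc_{p−s} + inc_{p−s+1} > 0` (`≤ 2` each) and `{ℓ′ ∖ {x}, ℓ′}` over `x ∈ L` when `e = 1` and `inc_{p−1} ≥ 1`
(`≤ 2n·e`), and `X̄₂(π)` is exactly this count.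
-/

namespace PercRepro.SixFour

open Finset ThmH

variable {α : Type*} [DecidableEq α] {M : Matroid α} [M.Finite] {G : Finset α}

namespace PLData

variable {D : PLData M G}

/-- **Shape `{x} ∪ λ`**: `G ∖ Z ⊆ P′` with `P′ ∩ G = {x} ∪ (P′ ∩ ρ)`, `x ∈ L`, `r(P′ ∩ ρ) = 2`, and `r(Z) ≤ 2`: then
`(D.ellF ∩ D.ρ).card = 1`, `(P′ ∩ ρ).card + 1 = p`, and `Z = (ℓ ∩ G).erase x ∨ Z = ℓ ∩ G`. -/
theorem shape_third (hs : Simple M) (hG : G ⊆ gr M) (h3 : 3 ≤ D.L.card) {P' : Finset α} {x : α} (hx : x ∈ D.L)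
    (htr : P' ∩ G = insert x (P' ∩ D.ρ)) (hr2 : M.eRk ((P' ∩ D.ρ : Finset α) : Set α) = 2) {Z : Finset α}
    (hZG : Z ⊆ G) (hZ2 : M.eRk (Z : Set α) ≤ 2) (hc : G \ Z ⊆ P') :
    (D.ellF ∩ D.ρ).card = 1 ∧ (P' ∩ D.ρ).card + 1 = D.ρ.card ∧ (Z = (D.ellF ∩ G).erase x ∨ Z = D.ellF ∩ G) := by
  have h2 : 2 ≤ D.L.card := by omega
  -- `G ∖ P′ ⊆ Z`, and `G ∖ P′ = (ρ ∖ λ) ∪ (L ∖ {x})`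
  have hGZ : ∀ w ∈ G, w ∉ P' → w ∈ Z := fun w hw hwP => by
    by_contra hwZ
    exact hwP (hc (Finset.mem_sdiff.2 ⟨hw, hwZ⟩))
  have hLx : ∀ w ∈ D.L, w ≠ x → w ∈ Z := by
    intro w hw hwx
    apply hGZ w (D.L_subset hw)
    intro hwP
    have : w ∈ P' ∩ G := Finset.mem_inter.2 ⟨hwP, D.L_subset hw⟩
    rw [htr, Finset.mem_insert] at this
    rcases this with h | h
    · exact hwx h
    · exact (Finset.mem_sdiff.1 hw).2 (Finset.mem_inter.1 (Finset.mem_inter.1 h).2).1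
  -- two points of `L ∖ {x}` in `Z`: `Z ⊆ ℓ`
  have hL1 : 1 < (D.L.erase x).card := by rw [Finset.card_erase_of_mem hx]; omega
  obtain ⟨u, hu, v, hv, huv⟩ := Finset.one_lt_card.1 hL1
  have huL := (Finset.mem_erase.1 hu).2
  have hvL := (Finset.mem_erase.1 hv).2
  have hZℓ : Z ⊆ D.ellF := subset_ellF_of_two_mem_L hs hG hZG hZ2 huL hvL huv
    (hLx u huL (Finset.mem_erase.1 hu).1) (hLx v hvL (Finset.mem_erase.1 hv).1)
  -- `ρ ∖ λ ⊆ Z ⊆ ℓ`, so `ρ ∖ λ ⊆ ℓ ∩ ρ`, which has `≤ 1` point; `ρ ∖ λ ≠ ∅` since `λ` has rank `2 < 3`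
  have hrl : D.ρ \ (P' ∩ D.ρ) ⊆ D.ellF ∩ D.ρ := by
    intro w hw
    rw [Finset.mem_sdiff] at hw
    have hwZ : w ∈ Z := hGZ w (D.ρ_subset hw.1) (fun hwP => hw.2 (Finset.mem_inter.2 ⟨hwP, hw.1⟩))
    exact Finset.mem_inter.2 ⟨hZℓ hwZ, hw.1⟩
  have hne : (D.ρ \ (P' ∩ D.ρ)).Nonempty := by
    by_contra hemp
    rw [Finset.not_nonempty_iff_eq_empty, Finset.sdiff_eq_empty_iff_subset] at hemp
    have : M.eRk ((D.ρ : Finset α) : Set α) ≤ 2 := by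
      rw [← hr2]
      exact M.eRk_mono (Finset.coe_subset.2 hemp)
    rw [eRk_ρ (D := D)] at this
    exact absurd this (by decide)
  have hcard1 : (D.ellF ∩ D.ρ).card ≤ 1 :=
    (Finset.card_le_card (Finset.inter_subset_inter (Finset.Subset.refl _) Finset.inter_subset_left)).trans
      (D.card_ellF_inter_le_one hs hG h2)
  have he : (D.ellF ∩ D.ρ).card = 1 := by
    have := Finset.card_le_card hrl
    have := Finset.card_pos.2 hne
    omega
  have hlam : (P' ∩ D.ρ).card + 1 = D.ρ.card := by
    have hsub : (D.ρ \ (P' ∩ D.ρ)).card = 1 := by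
      have := Finset.card_le_card hrl
      have := Finset.card_pos.2 hne
      omega
    have := Finset.card_sdiff_add_card_inter D.ρ (P' ∩ D.ρ)
    rw [Finset.inter_eq_right.2 Finset.inter_subset_right] at this
    omega
  refine ⟨he, hlam, ?_⟩
  -- `Z ⊆ ℓ ∩ G` and `(ℓ ∩ G) ∖ {x} ⊆ Z`
  have hZsub : Z ⊆ D.ellF ∩ G := Finset.subset_inter hZℓ hZG
  have hsup : (D.ellF ∩ G).erase x ⊆ Z := by
    intro w hw
    rw [Finset.mem_erase] at hw
    have hwℓG := hw.2
    rw [ellF_inter_G_eq hs hG h2] at hwℓG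
    rcases Finset.mem_union.1 hwℓG with hwL | hwρ
    · exact hLx w hwL hw.1
    · -- `w ∈ ℓ ∩ ρ = ρ ∖ λ` (the single point `z`): `w ∈ Z` since `z ∉ λ` (else `ρ ⊆ λ`)
      apply hGZ w (D.ρ_subset (Finset.mem_inter.1 hwρ).2)
      intro hwP
      -- `w ∈ P′ ∩ ρ`; with `ρ ∖ λ ⊆ ℓ ∩ ρ = {w}` we get `ρ ∖ λ = ∅` unless... `w ∈ λ` and `ρ ∖ λ ⊆ {w}` forces `ρ ∖ λ = ∅`
      obtain ⟨z, hz⟩ := hne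
      have hzrl := hrl hz
      have hzw : z = w := by
        have h1 : (D.ellF ∩ D.ρ).card = 1 := he
        obtain ⟨q, hq⟩ := Finset.card_eq_one.1 h1
        rw [hq, Finset.mem_singleton] at hzrl hwρ
        rw [hzrl, hwρ]
      rw [hzw] at hz
      exact (Finset.mem_sdiff.1 hz).2 (Finset.mem_inter.2 ⟨hwP, (Finset.mem_sdiff.1 hz).1⟩)
  by_cases hxZ : x ∈ Z
  · right
    refine Finset.Subset.antisymm hZsub ?_
    intro w hw
    by_cases hwx : w = x
    · rw [hwx]; exact hxZ
    · exact hsup (Finset.mem_erase.2 ⟨hwx, hw⟩)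
  · left
    refine Finset.Subset.antisymm ?_ hsup
    intro w hw
    rw [Finset.mem_erase]
    exact ⟨fun h => hxZ (h ▸ hw), hZsub hw⟩

/-! ## The count -/

/-- The size list filtered by a predicate counts the classes with that size property. -/
theorem sizes_filter_length (P : ℕ → Prop) [DecidablePred P] :
    (D.sizes.filter (fun s => decide (P s))).length = (D.classes.filter (fun C => P C.card)).card := by
  have hcoe : (D.sizes : Multiset ℕ) = D.classes.val.map Finset.card := by
    unfold sizes
    rw [Multiset.coe_reverse, Multiset.sort_eq]
  have h1 : (D.sizes.filter (fun s => decide (P s))).length =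
      Multiset.card ((D.sizes : Multiset ℕ).filter P) := by
    rw [Multiset.filter_coe, Multiset.coe_card]
  rw [h1, hcoe, Multiset.filter_map, Multiset.card_map]
  rfl

/-- `incOf (profile D) m = inc M ρ m` for `2 ≤ m ≤ 7`. -/
theorem incOf_profile' {m : ℕ} (h2 : 2 ≤ m) (h7 : m ≤ 7) : PL.incOf D.profile m = inc M D.ρ m := by
  unfold PL.incOf
  rw [if_pos h2, inc_profile (m - 2) (by omega), show m - 2 + 2 = m by omega]

/-- A rank-`2` trace `P′ ∩ ρ` of a plane `P′` is the trace of the line `cl(P′ ∩ ρ)`. -/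
theorem clF_inter_ρ_eq' (hG : G ⊆ gr M) {P' : Finset α} (hP' : P' ∈ planes M)
    (hr2 : M.eRk ((P' ∩ D.ρ : Finset α) : Set α) = 2) :
    clF M (P' ∩ D.ρ) ∈ lines M ∧ clF M (P' ∩ D.ρ) ∩ D.ρ = P' ∩ D.ρ := by
  have hsub : P' ∩ D.ρ ⊆ gr M := Finset.inter_subset_right.trans (D.ρ_subset.trans hG)
  obtain ⟨hL, hCL⟩ := clF_mem_lines hsub hr2
  refine ⟨hL, Finset.Subset.antisymm ?_ (Finset.subset_inter hCL Finset.inter_subset_right)⟩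
  intro w hw
  rw [Finset.mem_inter] at hw ⊢
  refine ⟨?_, hw.2⟩
  have hcl : (clF M (P' ∩ D.ρ) : Set α) ⊆ (P' : Set α) := by
    rw [coe_clF]
    calc M.closure ((P' ∩ D.ρ : Finset α) : Set α) ⊆ M.closure (P' : Set α) :=
          M.closure_subset_closure (Finset.coe_subset.2 Finset.inter_subset_left)
      _ = (P' : Set α) := (mem_planes.1 hP').2.1.closure
  exact Finset.mem_coe.1 (hcl (Finset.mem_coe.2 hw.1))

/-- **Lemma X̄₂ (E21-1 (b))**: `X₂ ≤ X̄₂(π(G))` for a normalisation of a plane-line set with plane traces `≤ g − 3`,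
`7 ≤ g ≤ 10`. -/
theorem X2cnt_le_Xbar2_profile' (hs : Simple M) (hG : G ⊆ gr M) (hr : M.eRk (G : Set α) = 4)
    (hpl : ∀ P ∈ planes M, (P ∩ G).card + 3 ≤ G.card) (hg : 7 ≤ G.card) (hg10 : G.card ≤ 10) :
    X2cnt M G ≤ PL.Xbar2 D.profile := by
  classical
  obtain ⟨h2, h3, -, hp7, -, -⟩ := steps_facts (D := D) hs hG hpl hg hg10
  have hplK : ∀ P ∈ planes M, (P ∩ G).card ≤ G.card - 3 := fun P hP => by have := hpl P hP; omega
  have hsum := D.card_ρ_add_card_L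
  have hcap : ∀ y ∈ D.ρ \ D.ellF, (D.lam y).card + 3 ≤ D.ρ.card := by
    intro y hy
    have := card_lam_add_card_L_le_K hs hG h2 hplK hy
    omega
  have he := e_profile_eq (D := D) hs hG h2
  have hp : D.profile.p = D.ρ.card := rfl
  have hn : D.profile.n = D.L.card := rfl
  have hcard1 : (D.ellF ∩ D.ρ).card ≤ 1 :=
    (Finset.card_le_card (Finset.inter_subset_inter (Finset.Subset.refl _) Finset.inter_subset_left)).trans
      (D.card_ellF_inter_le_one hs hG h2)
  have hρ3 : 3 ≤ D.ρ.card := three_le_card_of_eRk_eq_three (eRk_ρ (D := D))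
  -- the three families
  set A₀ : Finset (Finset α) := {D.L, D.L ∪ (D.ellF ∩ D.ρ)} with hA₀
  set A₁ : Finset (Finset α) := (D.classes.filter (fun C =>
      0 < PL.incOf D.profile (D.ρ.card - C.card) + PL.incOf D.profile (D.ρ.card - C.card + 1))).biUnion
      (fun C => {D.ρ \ C, clF M (D.ρ \ C) ∩ D.ρ}) with hA₁
  set A₂ : Finset (Finset α) := if (D.ellF ∩ D.ρ).card = 1 ∧ 1 ≤ PL.incOf D.profile (D.ρ.card - 1) then
      D.L.biUnion (fun x => {(D.ellF ∩ G).erase x, D.ellF ∩ G}) else ∅ with hA₂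
  -- every set counted by `X₂` is in `A₀ ∪ A₁ ∪ A₂`
  have hsub : G.powerset.filter (fun Z : Finset α => M.eRk (Z : Set α) ≤ 2 ∧ M.eRk ((G \ Z : Finset α) : Set α) ≤ 3) ⊆
      A₀ ∪ A₁ ∪ A₂ := by
    intro Z hZ
    rw [Finset.mem_filter, Finset.mem_powerset] at hZ
    obtain ⟨hZG, hZ2, hZc⟩ := hZ
    obtain ⟨P', hP', hcP', hr3⟩ := exists_plane_superset3 hG hr (Finset.sdiff_subset (s := G) (t := Z)) hZc
    rw [Finset.mem_union, Finset.mem_union]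
    rcases plane_trichotomy hs hG h2 hP' hr3 with rfl | ⟨y, hy, rfl⟩ | ⟨x, hx, htr, hr2, -⟩
    · -- shape `P₀`
      left; left
      rw [hA₀, Finset.mem_insert, Finset.mem_singleton]
      exact shape_P₀ hs hG h3 hZG hZ2 hcP'
    · -- shape `Π_y`
      left; right
      obtain ⟨hμ, hCμ, hbound, hZeq⟩ := shape_Pi hs hG h2 hy (hcap y hy) hZG hZ2 hcP'
      rw [hA₁, Finset.mem_biUnion]
      refine ⟨D.lam y, ?_, ?_⟩
      · rw [Finset.mem_filter]
        refine ⟨Finset.mem_image.2 ⟨y, hy, rfl⟩, ?_⟩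
        have hC : (D.ρ \ D.lam y).card = D.ρ.card - (D.lam y).card :=
          Finset.card_sdiff_of_subset Finset.inter_subset_right
        have hs1 : 1 ≤ (D.lam y).card := Finset.card_pos.2 ⟨y, mem_lam_self hs hG h2 (Finset.mem_sdiff.1 hy).1
          (Finset.mem_sdiff.1 hy).2⟩
        have hlo := Finset.card_le_card hCμ
        have hcy := hcap y hy
        rw [incOf_profile' (D := D) (by omega) (by omega), incOf_profile' (D := D) (by omega) (by omega)]
        unfold inc
        rcases (show (clF M (D.ρ \ D.lam y) ∩ D.ρ).card = D.ρ.card - (D.lam y).card ∨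
            (clF M (D.ρ \ D.lam y) ∩ D.ρ).card = D.ρ.card - (D.lam y).card + 1 by omega) with hm | hm
        · have : 0 < ((lines M).filter (fun L : Finset α => (L ∩ D.ρ).card = D.ρ.card - (D.lam y).card)).card :=
            Finset.card_pos.2 ⟨_, Finset.mem_filter.2 ⟨hμ, hm⟩⟩
          omega
        · have : 0 < ((lines M).filter (fun L : Finset α => (L ∩ D.ρ).card = D.ρ.card - (D.lam y).card + 1)).card :=
            Finset.card_pos.2 ⟨_, Finset.mem_filter.2 ⟨hμ, hm⟩⟩
          omega
      · rw [Finset.mem_insert, Finset.mem_singleton]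
        exact hZeq
    · -- shape `{x} ∪ λ`
      right
      obtain ⟨he1, hlam, hZeq⟩ := shape_third hs hG h3 hx htr hr2 hZG hZ2 hcP'
      have hinc : 1 ≤ PL.incOf D.profile (D.ρ.card - 1) := by
        rw [incOf_profile' (D := D) (by omega) (by omega)]
        unfold inc
        apply Finset.card_pos.2
        obtain ⟨hL, hLtr⟩ := clF_inter_ρ_eq' (D := D) hG hP' hr2
        exact ⟨clF M (P' ∩ D.ρ), Finset.mem_filter.2 ⟨hL, by rw [hLtr]; omega⟩⟩
      rw [hA₂, if_pos ⟨he1, hinc⟩, Finset.mem_biUnion]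
      refine ⟨x, hx, ?_⟩
      rw [Finset.mem_insert, Finset.mem_singleton]
      exact hZeq
  -- the counts
  have hc0 : A₀.card ≤ 1 + (D.ellF ∩ D.ρ).card := by
    rw [hA₀]
    by_cases h1 : (D.ellF ∩ D.ρ).card = 1
    · rw [h1]; exact Finset.card_le_two
    · have h0 : D.ellF ∩ D.ρ = ∅ := Finset.card_eq_zero.1 (by omega)
      rw [h0, Finset.union_empty, Finset.insert_eq_of_mem (Finset.mem_singleton_self _), Finset.card_singleton]
      omega
  have hc1 : A₁.card ≤ 2 * (D.classes.filter (fun C =>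
      0 < PL.incOf D.profile (D.ρ.card - C.card) + PL.incOf D.profile (D.ρ.card - C.card + 1))).card := by
    rw [hA₁]
    refine Finset.card_biUnion_le.trans ?_
    have := Finset.sum_le_card_nsmul (D.classes.filter (fun C =>
      0 < PL.incOf D.profile (D.ρ.card - C.card) + PL.incOf D.profile (D.ρ.card - C.card + 1)))
      (fun C => ({D.ρ \ C, clF M (D.ρ \ C) ∩ D.ρ} : Finset (Finset α)).card) 2 (fun C _ => Finset.card_le_two)
    rw [smul_eq_mul, mul_comm] at this
    exact this
  have hc2 : A₂.card ≤ 2 * D.L.card * (D.ellF ∩ D.ρ).card *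
      (if 1 ≤ PL.incOf D.profile (D.ρ.card - 1) then 1 else 0) := by
    rw [hA₂]
    split_ifs with hcond hind hind
    · refine Finset.card_biUnion_le.trans ?_
      rw [hcond.1, mul_one, mul_one]
      have := Finset.sum_le_card_nsmul D.L (fun x => (({(D.ellF ∩ G).erase x, D.ellF ∩ G} : Finset (Finset α))).card) 2
        (fun x _ => Finset.card_le_two)
      rw [smul_eq_mul, mul_comm] at this
      exact this
    · exact absurd hcond.2 hind
    · simp
    · simp
  -- assemble
  have hX : X2cnt M G ≤ A₀.card + A₁.card + A₂.card := by
    unfold X2cnt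
    exact (Finset.card_le_card hsub).trans ((Finset.card_union_le _ _).trans
      (add_le_add_left (Finset.card_union_le _ _) _))
  unfold PL.Xbar2
  rw [he, hp, hn, ← sizes_filter_length (D := D)
    (fun s => 0 < PL.incOf D.profile (D.ρ.card - s) + PL.incOf D.profile (D.ρ.card - s + 1))] at *
  have hsz : D.profile.sizes = D.sizes := rfl
  rw [hsz]
  omega

end PLData

end PercRepro.SixFour
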